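import Mathlib
import HarnessLib
import HarnessLib.Audit
import Summits.QuantumFields.Statement
import HarnessLib.Audit.Status.Attr

/-!
Route: FluxBootstrap

# Route FluxBootstrap — single-scale 't Hooft twist criterion + weak-coupling flux-scale gap +
continuum flux anchor give the lattice mass-gap clause for every G with centre

It suffices to show X := X_flux ∧ X_legs, where X_flux = SingleScaleFluxCriterion ∧ LargeBetaFluxGap
∧ ContinuumFluxAnchor is this
route's business (card flux-bootstrap-single-scale-criterion) and X_legs = PinnedFluxGapToYangMills
∧ CentrelessWeakCouplingYangMills are the
Osterwalder–Schrader legs (fed by the flux side WITH the anchor's pinning) and the centreless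
groups, owned by other cards and filed here
as support so that the deciding theorem typechecks. (Repair 2026-08-15, route-repair g2: the
misstated FluxScaleControlsGap is replaced by
the vacuity-audited LargeBetaFluxGap shared with route MarginalTwistOnset; the unpinned
FluxGapToYangMills by PinnedFluxGapToYangMills. Repair 2026-08-16, statement-revised p116790:
`YangMills` gained the weak-coupling conjunct `sch.HasWeakCouplingLimit` (β_k = 2/g₀² → ∞); on the
flux side it is PROVED in `closes` — the anchor forces β_k → ∞ and the legs return a scheme with
sch.β = β ∘ φ, φ strictly monotone — and for centreless G it rides inside the delegated leg,
CentrelessYangMills being superseded by CentrelessWeakCouplingYangMills = the revised clause for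
Z(G) = 1.)
X_flux in words. Let Z_{β,S}(z; μν) be Wilson's partition function in the unitary representation ρ
of the compact group G on the
symmetric torus (ℤ/S)⁴ with 't Hooft's twist — the central element z inserted in every
(μ,ν)-plaquette at (x_μ, x_ν) = (0, 0) — and
δ_{β,S}(z; μν) := 1 − Z_{β,S}(z; μν)/Z_{β,S}(1) the twist deficit ('t Hooft's e^{−F_el}, Greensite
(4.45)).
(1) SINGLE-SCALE FLUX CRITERION: for every (G, ρ) there are ε, c, C > 0, uniform in β ≥ 0 and in the
scale, such that
max_{z ∈ Z(G), μν} δ_{β,S₀} ≤ ε at ONE torus size S₀ ≥ 2 forces |δ_{β,S}| ≤ C e^{−c S²/S₀²} for all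
S ≥ S₀ (string tension ≥ c/S₀²).
(2) FLUX SCALE CONTROLS THE GAP AT WEAK COUPLING: for compact simple Lie G with Z(G) ≠ 1 and
faithful r, and β ≥ β₁(G, r, c, C),
Gaussian twist-deficit decay from scale S₀ forces volume-uniform exponential clustering of all
bounded gauge-invariant local observables
at rate m/S₀ on the tori (ℤ/(2S+1))⁴, S ≥ S₀ (the confinement ⇒ gap step, stated separately; no
centre-blind or bulk-transition instance).
(3) CONTINUUM FLUX ANCHOR: for every compact simple Lie G with Z(G) ≠ 1 there are a faithful r and,
for each ε ∈ (0,1), couplings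
β_k → ∞ and scales S₀(k) → ∞ at which the ε-criterion holds while failing at a comparable scale S' ≥
S₀(k)/2 ('t Hooft's criterion
pinned at the flux scale along a continuum-approaching sequence; foreseen split:
finite-physical-volume continuum limit of Z(z)/Z(1) +
one certified number at ℓ* ≈ 1.25 fm).
Lean: `Summit.QuantumFields.YangMills.Theses.FluxBootstrap.SingleScaleFluxCriterion ∧
Summit.QuantumFields.YangMills.Theses.FluxBootstrap.LargeBetaFluxGap ∧
Summit.QuantumFields.YangMills.Theses.FluxBootstrap.ContinuumFluxAnchor ∧
Summit.QuantumFields.YangMills.Theses.FluxBootstrap.PinnedFluxGapToYangMills ∧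
Summit.QuantumFields.YangMills.Theses.FluxBootstrap.CentrelessWeakCouplingYangMills`

## Assembly
Pure logic plus instance bookkeeping, PROVED sorry-free as `closes` (planner's Sketch.lean /
glue.lean, axioms propext /
Classical.choice / Quot.sound): fix G; if Z(G) = ⊥ use CentrelessWeakCouplingYangMills (revised
clause, weak-coupling conjunct included); otherwise ContinuumFluxAnchor gives the faithful r and
(T2 / second countability of G follow from the closed embedding r.ρ) the twisted partition function
Z := the defining integral;
SingleScaleFluxCriterion gives (ε, c, C), LargeBetaFluxGap gives (m, β₁) and K(A,B); apply the
anchor at min(ε, 1/2) to get β_k → ∞,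
S₀(k) → ∞ and the two-sided pin; eventually in k (S₀(k) ≥ 2, β_k ≥ β₁) the criterion at S₀(k) yields
Gaussian twist decay for all
S ≥ S₀(k), hence clustering at rate m/S₀(k) on all tori 2S+1, S ≥ S₀(k); PinnedFluxGapToYangMills,
fed the SAME r, the pin and the
clustering, returns the clause along a strictly monotone subsequence φ (sch.β = β ∘ φ), so
sch.HasWeakCouplingLimit = Tendsto sch.β atTop atTop follows from β_k → ∞
(StrictMono.tendsto_atTop); its scheme and OS data are the Statement's witnesses together with r.

Rationale: WHY THIS LINE. 't Hooft's twisted partition functions are the one family of lattice observables that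
are at once EXACT spectral data (Z(z)/Z(1) =
Σ_e χ_e(z) w_e with electric-flux weights w_e = Tr(P_e T^S)/Tr T^S ≥ 0, Thooft1979 §§IX–X,
TomboulisYaffe1985), UV-FINITE (a ratio of
partition functions differing by a boundary condition, measured to approach 1 at box size ≈ 1.25 fm
with area-law corrections:
KovacsTomboulis2000, ForcrandSmekal2002, Greensite2011Confinement §4.4) and RP-GLUABLE; the known
sufficient conditions for confinement
built on them (MackPetkova1980, TomboulisYaffe1985: Greensite (4.46)–(4.47)) are ASYMPTOTIC in the
box size. The line transplants the
finite-size-criterion architecture of statistical mechanics (DobrushinShlosman1985;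
RSW/one-certified-cube bootstraps) to twist deficits:
a threshold at ONE scale propagates to all scales (crux 2), the flux scale bounds the correlation
length (crux 3), and the hypothesis is
verified where it is cheapest — in a box of fixed physical size along β → ∞ (crux 4) — so that no
infinite-volume or fixed-coupling
confinement proof is ever needed. Imported: finite-size criteria / RP chessboard estimates
(statistical mechanics), transfer-matrix
spectral theory; certified numerics only in the foreseen split of crux 4. Nothing here restates a
prior route (none exist for
YangMills) and the negatives index is empty; the refuter's caveats on the card (FB(b) unsound as a
universal criterion, ε-universality)
are met by splitting FB(b) off as crux 3 with constants per (G, ρ).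

RANKED CRUXES. #2 SingleScaleFluxCriterion (crux) — card item F1 = FB(a) only. For every compact
metrisable group G and continuous unitary ρ : G → U(N) there are ε, c, C > 0 such that for every β ≥
0 and all torus sizes 2 ≤ S₀ ≤ S: if the twist deficit 1 − Z_{β,S₀}(z;q)/Z_{β,S₀}(1) is ≤ ε for
every central z and every plane q, then |1 − Z_{β,S}(z;q)/Z_{β,S}(1)| ≤ C exp(−c S²/S₀²) for every
central z and plane q. The twisted partition function enters through its defining formula (∀ Z, hZ →
…; definition request below). [difficulty: open-problem] (why it might fail: No gluing is known:
RP/chessboard bounds a twist on a 2S-torus only through OPEN vortex sheets with perimeter losses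
(TomboulisYaffe1985); twist free energies are not known super-additive; one re-entrant deficit (≤ε
at S₀, O(1) at S≫S₀) in some (G,ρ,β) kills it.) [Thooft1979, TomboulisYaffe1985, MackPetkova1980,
Greensite2011Confinement, DobrushinShlosman1985, KovacsTomboulis2000]
#3 LargeBetaFluxGap (crux) — confinement (flux) scale ⇒ gap AT WEAK COUPLING; SHARED verbatim with
route MarginalTwistOnset (its rank-4 crux, stmt-QuantumFields-9800); replaces this route's
FluxScaleControlsGap (stmt-QuantumFields-8950), which refuter rreview-0815T13-6 showed MISSTATED
(for centre-blind (G,ρ) the twist hypothesis is vacuous at every β and S₀ = 2, so it asserted a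
β-uniform lattice gap for SO(3)/SU(N)-adjoint/O(2)-charge-2 theories; EvidenceR3.lean). For every
compact simple Lie G with Z(G) ≠ 1, every faithful r : LatticeRep G and all c, C > 0 there are m > 0
and β₁ such that for all gauge-invariant local A, B there is K with: for every β ≥ β₁ and S₀ ≥ 2, if
|1 − Z_{β,S}(z;q)/Z_{β,S}(1)| ≤ C exp(−c S²/S₀²) for all S ≥ S₀, central z and planes q, then
|⟨A;τ_n B⟩_{β,(2S+1)⁴}| ≤ K exp(−m n/S₀) for all S ≥ S₀, n ≤ S (exactly the `latticeConnectedCorr`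
of `HasLatticeMassGap`). [deps: SingleScaleFluxCriterion] [difficulty: open-problem] (why it might
fail: σ>0 ⇏ gap: no inequality m ≥ c√σ is known for any (G,r); twist ratios are blind to
centre-neutral light 0⁺⁺ states (a critical endpoint reachable at large β by an exotic faithful
reducible r, Bhanot–Creutz); β ≥ β₁ only removes bulk transitions at bounded β.)
[TomboulisYaffe1985, BhanotCreutz1981, ForcrandSmekal2002, OsterwalderSeilerAnnPhys1978,
Greensite2011Confinement]
#4 ContinuumFluxAnchor (crux) — card items F2+F3 in the exact shape the assembly needs. For every
compact simple Lie group G with non-trivial centre there is a faithful unitary r such that for every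
ε ∈ (0,1) there are couplings β_k ≥ 0 with β_k → ∞ and scales S₀(k) → ∞ such that eventually in k:
the ε-criterion holds at S₀(k) (deficit ≤ ε for all central z and planes) AND fails at some scale S'
with S₀(k) ≤ 2S' (deficit > ε for some central z and plane) — the flux scale is finite, diverging,
and pinned; β_k → ∞ with two-sided pinning excludes strong-coupling and too-fine witnesses, and the
pin is now CONSUMED downstream (PinnedFluxGapToYangMills). [deps: SingleScaleFluxCriterion]
[difficulty: open-problem] (why it might fail: It IS 't Hooft's lattice criterion arbitrarily deep
in weak coupling: needs the finite-physical-volume continuum limit of Z(z)/Z(1) (beyond Bałaban's UV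
stability) plus one certified non-perturbative number at ℓ*≈1.25 fm, or a direct proof — all far
beyond print.) [KovacsTomboulis2000, ForcrandSmekal2002, Luscher1983, Balaban1989LargeFieldII,
EdwardsSmekal2009, Greensite2011Confinement]
#9 StrongCouplingFluxDecay (support) — IR base case and sanity check of the inline twisted partition
function: for every (G, ρ) there are β₀, c, C > 0 with |1 − Z_{β,S}(z;q)/Z_{β,S}(1)| ≤ C exp(−c S²)
for all 0 ≤ β < β₀, S ≥ 2, central z, planes q (convergent cluster expansion: only polymers whose
(μ,ν)-shadow covers the whole S×S plane feel the twist; Münster's vortex free energy at strong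
coupling). Adapt the tree's PROVED Osterwalder–Seiler expansion (StrongCoupling*.lean). [difficulty:
L] [Munster1981, OsterwalderSeilerAnnPhys1978, Seiler1982]
#5 PinnedFluxGapToYangMills (crux since rev 5, 2026-08-16: the crux-only deciding theorem makes
every unproved hypothesis of `closes` a crux; ledger rank field still 9) — the OS LEGS fed by this
route's flux side WITH the anchor's two-sided pinning threaded through — not this line's lever but
assumed by `closes`, hence a crux (cards os-legs-fine-print, torus-clause-is-thermal-v2,
parabolic-renormalised-trajectory, …); replaces FluxGapToYangMills (stmt-QuantumFields-8953, kept by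
route MarginalTwistOnset), whose hypothesis did not tie S₀(k) to β_k and was therefore met by
oversized scales carrying no continuum information (refuter rreview-0815T13-6 OBJECTION 2,
aggravated 0815T14-6). For every compact simple Lie G with Z(G) ≠ 1, every faithful r, ε ∈ (0,1), m
> 0, β_k ≥ 0 with β_k → ∞ and S₀(k) → ∞: if eventually in k the ε-criterion holds at S₀(k) AND fails
at some S' with S₀(k) ≤ 2S' (flux scale = physical scale ℓ*), and all gauge-invariant local A, B
cluster at rate m/S₀(k) uniformly on the tori (2S+1)⁴, S ≥ S₀(k), then the `YangMills` clause holds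
for G in the SAME representation r along a SUBSEQUENCE of (β_k) (sch.β = β ∘ φ, L_k ≥ S₀(φ k); OS
data T with IsYangMillsFor r sch T, non-triviality, non-Gaussianity, HasMassGap and
HasLatticeMassGap — the latter is the hypothesis re-indexed with a_k ≍ ℓ*/S₀(φ k), Δ = m/ℓ*).
Contains continuum-limit existence, E1 and non-triviality at scale ℓ*. [difficulty: open-problem]
(why it might fail: carries the whole continuum limit — clustering at the pinned flux scale gives
tightness at best; joint convergence of ALL species on ⁰𝒮 along one subsequence, E1 (full O(4)
invariance) and non-Gaussianity of tr F² at ℓ* are each open for Wilson's action.) [JaffeWitten2000,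
OsterwalderSeilerAnnPhys1978, Balaban1989LargeFieldII, Seiler1982, ChatterjeeYMProb2019]
#6 CentrelessWeakCouplingYangMills (crux since rev 5, 2026-08-16, same rule; ledger rank field 9) —
the REVISED `YangMills` clause (weak-coupling conjunct sch.HasWeakCouplingLimit included; supersedes
CentrelessYangMills stmt-QuantumFields-8954 for this route, 2026-08-16) for compact simple Lie G
with TRIVIAL centre (adjoint forms PSU(N), SO(2n+1), PSp(n), PSO(2n), E₆/ℤ₃, E₇/ℤ₂ and the
centreless simply connected G₂, F₄, E₈), where the twist criterion is void — NOT this route's claim: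
adjoint forms are card adjoint-forms-flux-uniform-quantifier (covering reduction; its K1 is exactly
flux-sector control of the cover, which cruxes 2–4 supply), G₂/F₄/E₈ need another mechanism.
[difficulty: open-problem] (why it might fail: it IS the summit clause for the adjoint forms and for
G₂, F₄, E₈ — the exceptional centreless groups have no twist sectors at all (HollandEtAl2003), and
descent of OS data from the cover for adjoint forms (ForcrandJahn2002) is unproved; false iff
Yang–Mills fails for a centreless G.) [JaffeWitten2000, Greensite2011Confinement, HollandEtAl2003,
ForcrandJahn2002]

TWO-LAYER PLAN. ContinuumFluxAnchor ⇐ FluxRatioContinuumLimit (card F2: along an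
asymptotic-freedom-tuned (β_k, a_k), Z_{β_k,⌈ℓ/a_k⌉}(z)/Z(1) → R(ℓ; z)
for every physical size ℓ, with R(ℓ) → 0 as ℓ → 0 — twists remove torons, Luscher1983 / card
kill-the-torons-rigid-boxes) →
CertifiedFluxBound (card F3: R(ℓ*; z) ≥ 1 − ε₀ at one ℓ* ≈ 1.25 fm for the explicit ε₀ of a
constructive proof of crux 2; interval
arithmetic on a twisted-sector character expansion or an SDP relaxation) → ContinuumFluxAnchor.
SingleScaleFluxCriterion ⇐ TwistGluing
(one RP/chessboard step: deficit at 2S bounded by a super-linear function of the deficits at S over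
all planes) → GluingIteration →
SingleScaleFluxCriterion. LargeBetaFluxGap ⇐ AreaLawFromFluxDecay (Tomboulis–Yaffe inequality W(C) ≤
(e^{−F_el})^{A/S²},
Greensite (4.46): provable-now-ish) → GapFromAreaLawAtFluxScale (the genuinely open half, β ≥ β₁) →
LargeBetaFluxGap. CentrelessWeakCouplingYangMills ⇐ CoveringReduction (adjoint-forms card) →
ExceptionalCentreless → CentrelessWeakCouplingYangMills. k ≤ 3 each, depth 1; nothing filed now.

KILL CRITERIA. ¬SingleScaleFluxCriterion for a compact simple G with Z(G) ≠ 1 and faithful ρ (e.g.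
SU(2) fundamental: a re-entrant twist deficit)
closes the route (`close --reason refuted:SingleScaleFluxCriterion`); a refutation only through
finite G or a reducible ρ sitting on a
critical endpoint forces a pivot (restate cruxes 2–3 for connected G / add an isotypic hypothesis).
¬LargeBetaFluxGap by a σ > 0
massless point met at arbitrarily large β on a line {β·r} forces a pivot to a co-hypothesis on local
mixing at the flux scale (merge with card
finite-size-criterion-crossover). ¬ContinuumFluxAnchor because deficits do NOT tend to 1 in femto
boxes for some (G, z) (twisted flat
connections of full dimension) → pivot to two-plane twists with isolated twist-eaters. Any route
proving the HasLatticeMassGap clause for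
all G moots cruxes 3–4; PinnedFluxGapToYangMills / CentrelessWeakCouplingYangMills are legs (cruxes
by the crux-only rule, open-problem strength, as hard as the continuum limit): their refutation
would refute the summit clause itself for some G, not this line in particular.

NOT DECOMPOSED YET. The constants (ε, c, C, m); the transfer-matrix facts behind the definitions (0
< Z(z) ≤ Z(1), z ↦ z⁻¹ symmetry, independence of the
stack position, electric-flux projector decomposition with w_e ≥ 0) — lemmas provers attach with
`--supports`; asymmetric tori and
thermal boxes (deliberately excluded: FiniteTemperatureDeconfinement); the AF-tuned scheme and the
rate in F2; the certified computation F3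
and large-rank uniformity (card F4); every OS leg inside PinnedFluxGapToYangMills (tightness along
the pinned subsequence, E1, non-triviality of tr F² at scale ℓ*); the covering reduction inside
CentrelessWeakCouplingYangMills.

CHEAPEST FALSIFIER. By hand, 't Hooft's free-photon flux formulas (Thooft1979 §XI (11.9)–(11.10))
for U(1)₄ / the Georgi–Glashow Coulomb phase: the twist
deficit on a symmetric box is 1 − ϑ-ratio(e^{−κ/e_R²}); if its infimum over the Coulomb phase (e_R²
↑ e_c² ≈ 6, Cardy / Jersák et al.)
were 0, the group-blind implication of crux 2 would be refuted by U(1) exactly as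
GroupBlindClusteringD4 — it evaluates to O(1) (≳ 0.5),
so the hypothesis, not the conclusion, fails in the Coulomb phase (done by hand, 2026-08-15). Next
cheapest (kit, uncertified MC, minutes):
twist deficits of ℤ₂ and SU(2) gauge theory on S = 2…6 across the crossover, looking for re-entrance
(deficit ≤ ε at S₀ then O(1) at 2S₀);
one reproducible re-entrant family with deficit dips → 0 kills crux 2.

NUMBERS. Z₋/Z₊ (SU(2), symmetric L⁴) reaches 1 within errors at L ≈ 1.25 fm (KovacsTomboulis2000;
Greensite2011Confinement §4.4, Fig. 4.3);
electric-flux free energies give σ consistent with Wilson loops and the 't Hooft string picture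
(ForcrandSmekal2002); Tomboulis–Yaffe:
W(C) ≤ (e^{−F_el})^{A(C)/(L_xL_y)} and F_mg ~ L_zL_t e^{−ρL_xL_y} ⇒ area law (Greensite
(4.46)–(4.47)); strong coupling: deficit ≲ S²(β/2N)^{S²}
(Munster1981; OS78 m ≥ −4 log(Cβ)); femto regime: electric-flux splittings O(g^{2/3}/L)
(Luscher1983) ⇒ deficit → 1 as β → ∞ at fixed S.
Items at open: 7 (3 cruxes, 3 support, 1 assembly); after repair g2 (2026-08-15): 7 (3 cruxes —
8949, 9800 shared, 8951 — 3 support — 8952, 10477, 8954 — 1 assembly); 8950 dropped (misstated,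
superseded by 9800), 8953 dropped here (kept by MarginalTwistOnset). After repair st-54739760
(2026-08-16, statement-revised p116790): 7 (3 cruxes — 8949, 9800, 8951 — 3 support — 8952, 10477,
CentrelessWeakCouplingYangMills replacing 8954 here (8954 kept by MarginalTwistOnset) — 1 assembly,
restated to the new chain); the new conjunct sch.HasWeakCouplingLimit is proved in `closes` on the
flux side and carried by the centreless leg otherwise. Rev 5 (same day, crux-only deciding theorem):
10477 and CentrelessWeakCouplingYangMills (15941) re-kinded support→crux, so the route has 5 cruxes
= exactly the binders of `closes` (ranks 2, 3, 4 and the two legs last), 1 support (8952, not a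
hypothesis), 1 assembly (15942).

DEFINITION REQUESTS. `twistedPartitionFunction` (topic
Literature/MathematicalPhysics/QuantumFieldTheory): for ρ : G →* U(N), β, the symmetric torus
(ℤ/S)⁴, z : G and a plane μ<ν, Z := ∫ exp(−β Σ_p (N − Re tr ρ(z^{[p ∈ stack(μν)]} U_p))) d(⊗Haar),
stack = (μ,ν)-plaquettes at
(x_μ,x_ν) = (0,0) — verbatim the `hZ` formula of the items — with API: positivity; value at z = 1 =
`partitionFunction.toReal`;
invariance under moving the stack (centre change of variables); z ↦ z⁻¹; |Z(z)| ≤ Z(1) and the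
electric-flux decomposition
Z(z)/Z(1) = Σ_e χ_e(z) w_e, w_e ≥ 0 (transfer matrix, Thooft1979 §IX, Seiler1982 Ch. 2). LANDED
(2026-08-15): Literature/MathematicalPhysics/QuantumFieldTheory/TwistedPartitionFunction.lean
(`twistedPartitionFunction`, `_def`, `_pos`, stack independence, z ↦ z⁻¹); provers bridge the inline
`hZ` by `rw [hZ, twistedPartitionFunction_def]` (grounder g17-22 Scratch rc0); the shared items keep
the inline `∀ Z, hZ →` form so that both routes' files stay byte-identical on them.

Novelty: Searches (2026-08-15): `lit search --hybrid "vortex free energy twisted boundary conditions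
confinement criterion lattice gauge theory"`
(15 book hits: Greensite2011Confinement pp. 45–47, Rebbi reprint vol., Montvay–Münster); `lit search
--hybrid "'t Hooft twist electric
flux magnetic flux free energy twisted partition function" --kind book` (12: Thooft1979 reprint in
't Hooft 1994 pp. 364–373 read);
`lit search --source arxiv "vortex free energy twisted boundary conditions SU(2)"` (2:
EdwardsSmekal2009 arXiv:0908.4030,
hep-lat/0009037); `lit search --source crossref "finite size criterion confinement vortex free
energy"` (10, none relevant);
`lit frontier QuantumFields --since 2020` (30 rows; relevant: arXiv:2605.16162 SO(3) deconfinement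
at strong coupling, arXiv:2605.02156
survey — none on twist criteria); `lit galaxy search "vortex free energy" --star all` (12:
Greensite, Rebbi, hep-lat/0412033
Quandt–Reinhardt–Engelhardt vortex free energy in a centre-vortex model); `lit galaxy search
"twisted boundary conditions" --star pdf`
(12, none relevant); `ledger negatives --problem QuantumFields` (0). OpenAlex/S2 rate-limited today
(noted).
Nearest prior art found: TomboulisYaffe1985 (doi:10.1007/bf01206134) and MackPetkova1980
(doi:10.1016/0003-4916(80)90121-9) — RP
inequalities and sufficient conditions for confinement from vortex / electric-flux free energies,
ASYMPTOTIC in the box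
(Greensite2011Confinement (4.46)–(4.47)); Thooft1979 (exact flux decomposition and duality); Ko  [refs: 10.1007/bf01206134, 10.1016/0003-4916(80, 0908.4030, 2605.16162, 2605.02156, doi:10.1007/bf01206134, doi:10.1016/0003-4916, Thooft1979, EdwardsSmekal2009, TomboulisYaffe1985, MackPetkova1980, KovacsTomboulis2000, ForcrandSmekal2002, DobrushinShlosman1985]

Barriers (technique_class: finite-size-flux-criterion, thooft-twist, rp-chessboard): - technique_class: finite-size-flux-criterion, thooft-twist, rp-chessboard
- Literature.Barriers.QuantumFields.AbelianDeconfinementD4: cruxes 2–3 are group-blind IMPLICATIONS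
whose hypothesis (ε-criterion at one scale) fails throughout the U(1)₄ Coulomb phase (twist deficit
≥ 1 − ϑ-ratio = O(1), cheapest falsifier); the conclusion is never claimed for all (G, β), so
`GroupBlindClusteringD4` / `GroupBlindIrrepAreaLawD4` are not instantiated; G enters through crux 4
(Z(G) ≠ 1, β_k → ∞ pinning).
- Literature.Barriers.QuantumFields.MigdalKadanoffGroupBlindness: no approximate recursion; exact RP
gluing of twist deficits only; same hypothesis-side evasion as above.
- Literature.Barriers.QuantumFields.FiniteTemperatureDeconfinement: only SYMMETRIC tori S⁴ and
(2S+1)⁴ appear; Borgs–Seiler deconfinement at temporal extent ≪ β is exactly why the criterion is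
never read on thermal boxes; the assembly's tori are the Statement's own.
- Literature.Barriers.QuantumFields.FixedCouplingUltralocality: ContinuumFluxAnchor forces β_k → ∞
with a diverging, two-sidedly pinned flux scale S₀(k) (no fixed-coupling or strong-coupling witness
can satisfy it), i.e. the limit is taken at the critical point β = ∞.
- Literature.Barriers.QuantumFields.UVStabilityNonUniqueness: the flux side needs no convergence of
correlation functions — in the foreseen split only ONE bounded ratio Z(z)/Z(1) at fixed physical
size must converge (or crux 4 is proved directly); it does bite on FluxGapToYangMills (continuum-l

Novelty grade: new-combination — ROUTE REVIEW rreview-0815T13-6 (refuter). Novelty INHERITED from card audit (new-combination). All 7 items elaborate (scratch copy R3.lean rc0); `closes` re-elaborates sorry-free, std axioms. OBJECTION 1 — crux FluxScaleControlsGap (stmt-QuantumFields-8950) MISSTATED; evidence EvidenceR3.lean (sorry (refuter refuter-rreview-0815T13-6-0, 2026-08-15T14:16:46Z; prior: Thooft1979; doi:10.1007/bf01206134 (Tomboulis–Yaffe 1985); doi:10.1016/0003-4916(80)90121-9 (Mack–Petkova 1980); KovacsTomboulis2000; ForcrandSmekal2002; DobrushinShlosman1985/DKS1985; Literature.Barriers.QuantumFields.AbelianDeconfinementD4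 (GroupBlindClusteringD4 / AbelianMasslessPhaseD4))

History (route lifecycle, newest last):
- 2026-08-15T16:19:11Z · rev 3: restated Assembly (stmt-QuantumFields-8955) — route-repair g2 (cone + review objections): (i) CONE: needs 0 of the 5 flagged facts — isSpecification_ymSpecification (refuted-as-stated; _t2 proved), ClayYang (planner-rrepair-QuantumFields-FluxBootstrap-c0805aaa-g2-0)
- 2026-08-15T16:19:11Z · rev 3: dropped FluxScaleControlsGap, FluxGapToYangMills — route-repair g2 (cone + review objections): (i) CONE: needs 0 of the 5 flagged facts — isSpecification_ymSpecification (refuted-as-stated; _t2 proved), ClayYang (planner-rrepair-QuantumFields-FluxBootstrap-c0805aaa-g2-0)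
- 2026-08-16T17:36:20Z · rev 4: restated CentrelessYangMills (stmt-QuantumFields-8954), Assembly (stmt-QuantumFields-10602) — route-repair statement-revised p116790: YangMills gained conjunct sch.HasWeakCouplingLimit. Flux side (Z(G)≠⊥): PROVED in closes from ContinuumFluxAnchor's Tend (planner-rrepair-QuantumFields-FluxBootstrap-st-54739760-0)
- 2026-08-23T09:46:27Z · DORMANT — reconciler: no traction for 6 d (last activity statement-grounded at 2026-08-17T08:05:57Z); parked, not closed — `ledger route dormant route-QuantumFields-FluxB (operator:999:2877815)
- 2026-08-28T21:16:01Z · REACTIVATED — reconciler: reactivated — activity statement-closed at 2026-08-28T18:35:42Z after parking at 2026-08-23T09:46:27Z (operator:999:2338184)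

sub-problem: YangMills · status: open · opened planner-plancard-QuantumFields-YangMills-flux-407c5c0d-0 2026-08-15T13:43:52Z · rev 6 · ledger route-QuantumFields-FluxBootstrap
GENERATED by the gate from the ledger (D-0016/17). Provers cite these decls: `theorem foo : Summit.QuantumFields.YangMills.Theses.FluxBootstrap.<Decl> := …` in Summits/QuantumFields/YangMills/Theorems/<Name>.lean.
-/

namespace Summit.QuantumFields.YangMills.Theses.FluxBootstrap

open scoped BigOperators Topology Manifold Classical MeasureTheory ProbabilityTheory Matrix InnerProductSpace ComplexConjugate ContinuousMap
open Filter Set Function TopologicalSpace MeasureTheory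

attribute [summit_statement] _root_.YangMills

/-- item stmt-QuantumFields-8949 · crux · rank 2 · open · by planner
why it might fail: No RP/chessboard gluing of twist deficits is known (TY85: open vortex sheets, perimeter losses); deficits not known monotone/super-additive in S; centre-insensitivity is a weak notion of disorder: one re-entrant (G,ρ,β) — deficit ≤ε at S₀, O(1) at S≫S₀, e.g. near a 1st-order bulk point — kills it.
sources: TomboulisYaffe1985, Thooft1979, MackPetkova1980, DobrushinShlosman1985, KovacsTomboulis2000, BhanotCreutz1981
[crux] card item F1 = FB(a) only. For every compact metrisable group G and continuous unitary ρ : G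
→ U(N) there are ε, c, C > 0 such that for every β ≥ 0 and all torus sizes 2 ≤ S₀ ≤ S: if the twist
deficit 1 − Z_{β,S₀}(z;q)/Z_{β,S₀}(1) is ≤ ε for every central z and every plane q, then |1 −
Z_{β,S}(z;q)/Z_{β,S}(1)| ≤ C exp(−c S²/S₀²) for every central z and plane q. The twisted partition
function enters through its defining formula (∀ Z, hZ → …; definition request below). [difficulty:
open-problem] -/
@[route_item "route-QuantumFields-FluxBootstrap", crux]
def SingleScaleFluxCriterion : Prop :=
  ∀ (G : Type) [Group G] [TopologicalSpace G] [IsTopologicalGroup G] [CompactSpace G] [T2Space G] [SecondCountableTopology G] [MeasurableSpace G] [BorelSpace G] (N : ℕ) (ρ : G →* Matrix (Fin N) (Fin N) ℂ), Continuous ρ → (∀ g, ρ g ∈ Matrix.unitaryGroup (Fin N) ℂ) → ∀ Z : ℝ → ℕ → G → {p : Fin 4 × Fin 4 // p.1 < p.2} → ℝ, (∀ (β : ℝ) (L : ℕ) (z : G) (q : {p : Fin 4 × Fin 4 // p.1 < p.2}), Z β (L + 1) z q = ∫ U : Literature.MathematicalPhysics.QuantumFieldTheory.GaugeConfig 4 (L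 + 1) G, Real.exp (-(β * ∑ p : Literature.MathematicalPhysics.QuantumFieldTheory.Plaquette 4 (L + 1), ((N : ℝ) - (ρ ((if p.2 = q ∧ p.1 q.1.1 = 0 ∧ p.1 q.1.2 = 0 then z else 1) * Literature.MathematicalPhysics.QuantumFieldTheory.plaquetteHolonomy U p.1 p.2.1.1 p.2.1.2)).trace.re))) ∂(MeasureTheory.Measure.pi fun _ : Literature.MathematicalPhysics.QuantumFieldTheory.Edge 4 (L + 1) => Literature.MathematicalPhysics.QuantumFieldTheory.haarProbability G)) → ∃ ε c C : ℝ, 0 < ε ∧ 0 < c ∧ 0 < C ∧ ∀ β : ℝ, 0 ≤ β → ∀ S₀ S : ℕ, 2 ≤ S₀ → S₀ ≤ S → (∀ z ∈ Subgroup.center G, ∀ q, 1 - Z β S₀ z q / Z β S₀ 1 q ≤ ε) → ∀ z ∈ Subgroup.center G, ∀ q, |1 - Z β S z q / Z β S 1 q| ≤ C * Real.exp (-(c * ((S : ℝ) / S₀) ^ 2))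

/-- item stmt-QuantumFields-9800 · crux · rank 3 · open · by planner
why it might fail: σ>0 ⇏ gap: no inequality m ≥ c√σ is known for any (G,r); twist ratios are blind to centre-neutral light 0⁺⁺ states (a critical endpoint reachable at large β by an exotic faithful reducible r, Bhanot–Creutz); β ≥ β₁ only removes bulk transitions at bounded β.
sources: TomboulisYaffe1985, BhanotCreutz1981, ForcrandSmekal2002, OsterwalderSeilerAnnPhys1978, Greensite2011Confinement, ChatterjeeYMProb2019
[crux] confinement scale ⇒ gap at weak coupling, in the shape the glue needs and AUDITED against
vacuity (planner's variant of FluxBootstrap.FluxScaleControlsGap, which is refutable: for centreless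
G its hypothesis is vacuous and it asserts β-uniform clustering). For every compact simple Lie G
with Z(G) ≠ 1, every faithful r and all c, C > 0 there are m > 0 and β₁ such that for all
gauge-invariant local A, B there is K with: for every β ≥ β₁ and S₀ ≥ 2, if |deficit_{β,S}(z;q)| ≤ C
e^{−cS²/S₀²} for all S ≥ S₀, central z and planes q, then |⟨A;τ_n B⟩_{β,(2S+1)⁴}| ≤ K e^{−m n/S₀}
for all S ≥ S₀, n ≤ S (exactly the latticeConnectedCorr of HasLatticeMassGap). [deps:
SingleScaleFluxCriterion] [difficulty: open-problem] -/
@[route_item "route-QuantumFields-FluxBootstrap", crux]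
def LargeBetaFluxGap : Prop :=
  ∀ (G : Type) [Group G] [TopologicalSpace G] [IsTopologicalGroup G] [CompactSpace G], Literature.MathematicalPhysics.QuantumFieldTheory.IsCompactSimpleLieGroup G → Subgroup.center G ≠ ⊥ → letI : MeasurableSpace G := borel G; haveI : BorelSpace G := ⟨rfl⟩; ∀ r : Literature.MathematicalPhysics.QuantumFieldTheory.LatticeRep G, ∀ Z : ℝ → ℕ → G → {p : Fin 4 × Fin 4 // p.1 < p.2} → ℝ, (∀ (β : ℝ) (L : ℕ) (z : G) (q : {p : Fin 4 × Fin 4 // p.1 < p.2}), Z β (L + 1) z q = ∫ U : Literature.MathematicalPhysics.QuantumFieldTheory.GaugeConfig 4 (L + 1) G, Real.exp (-(β * ∑ p : Literature.MathematicalPhysics.QuantumFieldTheory.Plaquette 4 (L + 1), ((r.N : ℝ) - (r.ρ ((if p.2 = q ∧ p.1 q.1.1 = 0 ∧ p.1 q.1.2 = 0 then z else 1) * Literature.MathematicalPhysics.QuantumFieldTheory.plaquetteHolonomy U p.1 p.2.1.1 p.2.1.2)).trace.re))) ∂(MeasureTheory.Measure.pi fun _ : Literature.MathematicalPhysics.QuantumFieldTheory.Edge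 4 (L + 1) => Literature.MathematicalPhysics.QuantumFieldTheory.haarProbability G)) → ∀ c C : ℝ, 0 < c → 0 < C → ∃ m β₁ : ℝ, 0 < m ∧ ∀ A B : Literature.MathematicalPhysics.QuantumFieldTheory.YMSpecies G, ∃ K : ℝ, ∀ β : ℝ, β₁ ≤ β → ∀ S₀ : ℕ, 2 ≤ S₀ → (∀ S : ℕ, S₀ ≤ S → ∀ z ∈ Subgroup.center G, ∀ q, |1 - Z β S z q / Z β S 1 q| ≤ C * Real.exp (-(c * ((S : ℝ) / S₀) ^ 2))) → ∀ S : ℕ, S₀ ≤ S → ∀ n : ℕ, n ≤ S → |Literature.MathematicalPhysics.QuantumFieldTheory.latticeConnectedCorr r.ρ β (2 * S + 1) A.F B.F n| ≤ K * Real.exp (-(m * n / S₀))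

/-- item stmt-QuantumFields-8951 · crux · rank 4 · open · by planner
why it might fail: 't Hooft's criterion at arbitrarily weak coupling for every simple G with centre (confinement survives a→0): false iff such a G deconfines at large β in every faithful r — a Coulomb window as U(1)₄ provably has (Guth; Fröhlich–Spencer); no proof w/o finite-volume control of Z(z)/Z(1) past Bałaban.
sources: Thooft1979, KovacsTomboulis2000, ForcrandSmekal2002, Guth1980, FrohlichSpencerCMP1982, Luscher1983
[crux] card items F2+F3 in the exact shape the assembly needs. For every compact simple Lie group G
with non-trivial centre there is a faithful unitary r such that for every ε ∈ (0,1) there are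
couplings β_k ≥ 0 with β_k → ∞ and scales S₀(k) → ∞ such that eventually in k: the ε-criterion holds
at S₀(k) (deficit ≤ ε for all central z and planes) AND fails at some scale S' with S₀(k) ≤ 2S'
(deficit > ε for some central z and plane) — the flux scale is finite, diverging, and pinned; β_k →
∞ with two-sided pinning excludes strong-coupling and too-fine witnesses. [deps:
SingleScaleFluxCriterion] [difficulty: open-problem] -/
@[route_item "route-QuantumFields-FluxBootstrap", crux]
def ContinuumFluxAnchor : Prop :=
  ∀ (G : Type) [Group G] [TopologicalSpace G] [IsTopologicalGroup G] [CompactSpace G], Literature.MathematicalPhysics.QuantumFieldTheory.IsCompactSimpleLieGroup G → Subgroup.center G ≠ ⊥ → letI : MeasurableSpace G := borel G; haveI : BorelSpace G := ⟨rfl⟩; ∃ r : Literature.MathematicalPhysics.QuantumFieldTheory.LatticeRep G, ∀ Z : ℝ → ℕ → G → {p : Fin 4 × Fin 4 // p.1 < p.2} → ℝ, (∀ (β : ℝ) (L : ℕ) (z : G) (q : {p : Fin 4 × Fin 4 // p.1 < p.2}), Z β (L + 1) z q = ∫ U : Literature.MathematicalPhysics.QuantumFieldTheory.GaugeConfig 4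 (L + 1) G, Real.exp (-(β * ∑ p : Literature.MathematicalPhysics.QuantumFieldTheory.Plaquette 4 (L + 1), ((r.N : ℝ) - (r.ρ ((if p.2 = q ∧ p.1 q.1.1 = 0 ∧ p.1 q.1.2 = 0 then z else 1) * Literature.MathematicalPhysics.QuantumFieldTheory.plaquetteHolonomy U p.1 p.2.1.1 p.2.1.2)).trace.re))) ∂(MeasureTheory.Measure.pi fun _ : Literature.MathematicalPhysics.QuantumFieldTheory.Edge 4 (L + 1) => Literature.MathematicalPhysics.QuantumFieldTheory.haarProbability G)) → ∀ ε : ℝ, 0 < ε → ε < 1 → ∃ (β : ℕ → ℝ) (S₀ : ℕ → ℕ), (∀ k, 0 ≤ β k) ∧ Filter.Tendsto β Filter.atTop Filter.atTop ∧ Filter.Tendsto S₀ Filter.atTop Filter.atTop ∧ ∀ᶠ k in Filter.atTop, (∀ z ∈ Subgroup.center G, ∀ q, 1 - Z (β k) (S₀ k) z q / Z (β k) (S₀ k) 1 q ≤ ε) ∧ (∃ S' : ℕ, 2 ≤ S' ∧ S₀ k ≤ 2 * S' ∧ ∃ z ∈ Subgroup.center G, ∃ q, ε < 1 - Z (β k)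 S' z q / Z (β k) S' 1 q)

/-- item stmt-QuantumFields-10477 · crux · rank 9 · open · by planner
why it might fail: Carries the whole continuum limit: clustering at the pinned flux scale gives tightness at best; joint convergence of ALL species on ⁰𝒮 along one subsequence, E1 (full O(4) invariance) and non-Gaussianity of tr F² at ℓ* are each open for Wilson's action and may fail.
sources: JaffeWitten2000, OsterwalderSeilerAnnPhys1978, Balaban1989LargeFieldII, Seiler1982, ChatterjeeYMProb2019
[support] the OS LEGS fed by THIS route's flux side, with the anchor's two-sided pinning threaded
through (repairs the structural objection of rreview-0815T13-6 / 0815T14-6 to FluxGapToYangMills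
stmt-QuantumFields-8953, whose hypothesis did not tie S₀(k) to β_k and was therefore met by
oversized scales carrying no continuum information). For every compact simple Lie G with Z(G) ≠ 1,
every faithful r : LatticeRep G (Z = its twisted Wilson partition function via hZ), every ε ∈ (0,1),
m > 0, couplings β_k ≥ 0 with β_k → ∞ and scales S₀(k) → ∞: IF eventually in k the ε-criterion holds
at S₀(k) (twist deficit ≤ ε for all central z and planes) AND fails at some S' with S₀(k) ≤ 2S' (the
flux scale is the physical scale ℓ*: S₀(k) is NOT oversized), AND all gauge-invariant local A, B
cluster at rate m/S₀(k) uniformly on the tori (2S+1)⁴, S ≥ S₀(k) (exactly what ContinuumFluxAnchor +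
SingleScaleFluxCriterion + LargeBetaFluxGap deliver), THEN the `YangMills` clause holds for G IN THE
SAME REPRESENTATION r and ALONG A SUBSEQUENCE of (β_k): ∃ sch T with sch.β = β ∘ φ (φ strictly
increasing), tori L_k ≥ S₀(φ k), IsYangMillsFor r sch T, non-trivial non-Gaussian curvature,
T.HasMassGap Δ ∧ HasLatt -/
@[route_item "route-QuantumFields-FluxBootstrap", crux]
def PinnedFluxGapToYangMills : Prop :=
  ∀ (G : Type) [Group G] [TopologicalSpace G] [IsTopologicalGroup G] [CompactSpace G], Literature.MathematicalPhysics.QuantumFieldTheory.IsCompactSimpleLieGroup G → Subgroup.center G ≠ ⊥ → letI : MeasurableSpace G := borel G; haveI : BorelSpace G := ⟨rfl⟩; ∀ (r : Literature.MathematicalPhysics.QuantumFieldTheory.LatticeRep G) (Z : ℝ → ℕ → G → {p : Fin 4 × Fin 4 // p.1 < p.2} → ℝ), (∀ (β : ℝ) (L : ℕ) (z : G) (q : {p : Fin 4 × Fin 4 // p.1 < p.2}), Z β (L + 1) z q = ∫ U : Literature.MathematicalPhysics.QuantumFieldTheory.GaugeConfig 4 (L + 1) G, Real.exp (-(β * ∑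 p : Literature.MathematicalPhysics.QuantumFieldTheory.Plaquette 4 (L + 1), ((r.N : ℝ) - (r.ρ ((if p.2 = q ∧ p.1 q.1.1 = 0 ∧ p.1 q.1.2 = 0 then z else 1) * Literature.MathematicalPhysics.QuantumFieldTheory.plaquetteHolonomy U p.1 p.2.1.1 p.2.1.2)).trace.re))) ∂(MeasureTheory.Measure.pi fun _ : Literature.MathematicalPhysics.QuantumFieldTheory.Edge 4 (L + 1) => Literature.MathematicalPhysics.QuantumFieldTheory.haarProbability G)) → ∀ (ε m : ℝ) (β : ℕ → ℝ) (S₀ : ℕ → ℕ), 0 < ε → ε < 1 → 0 < m → (∀ k, 0 ≤ β k) → Filter.Tendsto β Filter.atTop Filter.atTop → Filter.Tendsto S₀ Filter.atTop Filter.atTop → (∀ᶠ k in Filter.atTop, (∀ z ∈ Subgroup.center G, ∀ q, 1 - Z (β k) (S₀ k) z q / Z (β k) (S₀ k) 1 q ≤ ε) ∧ (∃ S' : ℕ, 2 ≤ S' ∧ S₀ k ≤ 2 * S' ∧ ∃ z ∈ Subgroup.center G, ∃ q, ε < 1 - Z (β k) S' z q / Z (β k) S' 1 q)) → (∀ A B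 : Literature.MathematicalPhysics.QuantumFieldTheory.YMSpecies G, ∃ K : ℝ, ∀ᶠ k in Filter.atTop, ∀ S : ℕ, S₀ k ≤ S → ∀ n : ℕ, n ≤ S → |Literature.MathematicalPhysics.QuantumFieldTheory.latticeConnectedCorr r.ρ (β k) (2 * S + 1) A.F B.F n| ≤ K * Real.exp (-(m * n / S₀ k))) → ∃ (sch : Literature.MathematicalPhysics.QuantumFieldTheory.SpeciesScheme (Literature.MathematicalPhysics.QuantumFieldTheory.YMSpecies G)) (T : Literature.MathematicalPhysics.QuantumFieldTheory.OSData (Literature.MathematicalPhysics.QuantumFieldTheory.YMSpecies G) 4), (∃ φ : ℕ → ℕ, StrictMono φ ∧ ∀ k, sch.β k = β (φ k) ∧ S₀ (φ k) ≤ sch.L k) ∧ Literature.MathematicalPhysics.QuantumFieldTheory.IsYangMillsFor r sch T ∧ T.IsNontrivial r.curvature ∧ T.IsNonGaussian r.curvature ∧ ∃ Δ > 0, T.HasMassGap Δ ∧ Literature.MathematicalPhysics.QuantumFieldTheory.HasLatticeMassGap r sch Δ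

/-- item stmt-QuantumFields-15941 · crux · rank 9 · open · by planner
why it might fail: It IS the summit clause for PSU(N), SO(2n+1), PSp(n), PSO(2n), E₆/ℤ₃, E₇/ℤ₂, G₂, F₄, E₈: G₂/F₄/E₈ have no twist sectors at all (HollandEtAl2003) and descent of OS data from the cover for adjoint forms (ForcrandJahn2002) is unproved; false iff Yang–Mills fails for a centreless G.
sources: JaffeWitten2000, Greensite2011Confinement, HollandEtAl2003, ForcrandJahn2002
[support] the REVISED `YangMills` clause (statement re-type 2026-08-16, p116790: first conjunct
`sch.HasWeakCouplingLimit`, i.e. β_k = 2/g₀² → ∞ along the scheme) for compact simple Lie G with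
TRIVIAL centre (adjoint forms PSU(N), SO(2n+1), PSp(n), PSO(2n), E₆/ℤ₃, E₇/ℤ₂ and the centreless
simply connected G₂, F₄, E₈), where the twist criterion is void — NOT this route's claim (card
adjoint-forms-flux-uniform-quantifier: covering reduction, whose K1 is flux-sector control of the
cover, supplied by cruxes 2–4; G₂/F₄/E₈ need another mechanism). Supersedes CentrelessYangMills
(stmt-QuantumFields-8954, the pre-revision clause, kept by route MarginalTwistOnset) for this route:
the weak-coupling conjunct cannot be manufactured from the old clause, so it is carried as part of
this delegated leg. [difficulty: open-problem] -/
@[route_item "route-QuantumFields-FluxBootstrap", crux]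
def CentrelessWeakCouplingYangMills : Prop :=
  ∀ (G : Type) [Group G] [TopologicalSpace G] [IsTopologicalGroup G] [CompactSpace G], Literature.MathematicalPhysics.QuantumFieldTheory.IsCompactSimpleLieGroup G → Subgroup.center G = ⊥ → letI : MeasurableSpace G := borel G; haveI : BorelSpace G := ⟨rfl⟩; ∃ (r : Literature.MathematicalPhysics.QuantumFieldTheory.LatticeRep G) (sch : Literature.MathematicalPhysics.QuantumFieldTheory.SpeciesScheme (Literature.MathematicalPhysics.QuantumFieldTheory.YMSpecies G)) (T : Literature.MathematicalPhysics.QuantumFieldTheory.OSData (Literature.MathematicalPhysics.QuantumFieldTheory.YMSpecies G) 4), sch.HasWeakCouplingLimit ∧ Literature.MathematicalPhysics.QuantumFieldTheory.IsYangMillsFor r sch T ∧ T.IsNontrivial r.curvature ∧ T.IsNonGaussian r.curvature ∧ ∃ Δ > 0, T.HasMassGap Δ ∧ Literature.MathematicalPhysics.QuantumFieldTheory.HasLatticeMassGap r sch Δ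

/-- item stmt-QuantumFields-8952 · support · rank 9 · open · by planner
sources: Munster1981, OsterwalderSeilerAnnPhys1978, Seiler1982
[support] IR base case and sanity check of the inline twisted partition function: for every (G, ρ)
there are β₀, c, C > 0 with |1 − Z_{β,S}(z;q)/Z_{β,S}(1)| ≤ C exp(−c S²) for all 0 ≤ β < β₀, S ≥ 2,
central z, planes q (convergent cluster expansion: only polymers whose (μ,ν)-shadow covers the whole
S×S plane feel the twist; Münster's vortex free energy at strong coupling). Adapt the tree's PROVED
Osterwalder–Seiler expansion (StrongCoupling*.lean). [difficulty: L] -/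
@[route_item "route-QuantumFields-FluxBootstrap"]
def StrongCouplingFluxDecay : Prop :=
  ∀ (G : Type) [Group G] [TopologicalSpace G] [IsTopologicalGroup G] [CompactSpace G] [T2Space G] [SecondCountableTopology G] [MeasurableSpace G] [BorelSpace G] (N : ℕ) (ρ : G →* Matrix (Fin N) (Fin N) ℂ), Continuous ρ → (∀ g, ρ g ∈ Matrix.unitaryGroup (Fin N) ℂ) → ∀ Z : ℝ → ℕ → G → {p : Fin 4 × Fin 4 // p.1 < p.2} → ℝ, (∀ (β : ℝ) (L : ℕ) (z : G) (q : {p : Fin 4 × Fin 4 // p.1 < p.2}), Z β (L + 1) z q = ∫ U : Literature.MathematicalPhysics.QuantumFieldTheory.GaugeConfig 4 (L + 1) G, Real.exp (-(β * ∑ p : Literature.MathematicalPhysics.QuantumFieldTheory.Plaquette 4 (L + 1), ((N : ℝ) - (ρ ((if p.2 = q ∧ p.1 q.1.1 = 0 ∧ p.1 q.1.2 = 0 then z else 1) * Literature.MathematicalPhysics.QuantumFieldTheory.plaquetteHolonomy U p.1 p.2.1.1 p.2.1.2)).trace.re))) ∂(MeasureTheory.Measure.pi fun _ : Literature.MathematicalPhysics.QuantumFieldTheory.Edge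 4 (L + 1) => Literature.MathematicalPhysics.QuantumFieldTheory.haarProbability G)) → ∃ β₀ c C : ℝ, 0 < β₀ ∧ 0 < c ∧ 0 < C ∧ ∀ β : ℝ, 0 ≤ β → β < β₀ → ∀ S : ℕ, 2 ≤ S → ∀ z ∈ Subgroup.center G, ∀ q, |1 - Z β S z q / Z β S 1 q| ≤ C * Real.exp (-(c * (S : ℝ) ^ 2))

-- earlier Assembly (stmt-QuantumFields-10602, replaced 2026-08-16T17:36:20Z -> stmt-QuantumFields-15942): retired by None — SingleScaleFluxCriterion → LargeBetaFluxGap → ContinuumFluxAnchor → PinnedFluxGapToYangMills → CentrelessYangMills → YangMills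
-- earlier Assembly (stmt-QuantumFields-8955, replaced 2026-08-15T16:19:11Z -> stmt-QuantumFields-10602): retired by None — SingleScaleFluxCriterion → FluxScaleControlsGap → ContinuumFluxAnchor → FluxGapToYangMills → CentrelessYangMills → YangMills
/-- item stmt-QuantumFields-15942 · assembly · rank 1 · closed · proved by Summit.QuantumFields.YangMills.Theorems.fluxBootstrap_assembly_proof (prover) · by planner
sources: JaffeWitten2000, Thooft1979
[assembly] SingleScaleFluxCriterion → LargeBetaFluxGap → ContinuumFluxAnchor →
PinnedFluxGapToYangMills → CentrelessWeakCouplingYangMills → YangMills (the sub-problem constant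
`YangMills` of Summits/QuantumFields/YangMills/Statement.lean, root namespace, REVISED 2026-08-16
with the weak-coupling conjunct); = the type of the deciding theorem `closes` after repair
st-54739760 (the Z(G) ≠ ⊥ branch proves `sch.HasWeakCouplingLimit` from the anchor's β_k → ∞ along
the legs' strictly monotone subsequence; the centreless branch carries it in
CentrelessWeakCouplingYangMills). -/
@[route_item "route-QuantumFields-FluxBootstrap"]
def Assembly : Prop :=
  SingleScaleFluxCriterion → LargeBetaFluxGap → ContinuumFluxAnchor → PinnedFluxGapToYangMills → CentrelessWeakCouplingYangMills → YangMills

-- `Assembly` holds: proved by `Summit.QuantumFields.YangMills.Theorems.fluxBootstrap_assembly_proof` (its module imports this route file, so no `_holds` link can be stated here).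

-- records of items no longer active in this route (dropped / restated):
-- earlier CentrelessYangMills (stmt-QuantumFields-8954, replaced 2026-08-16T17:36:20Z -> stmt-QuantumFields-15941): retired by None — ∀ (G : Type) [Group G] [TopologicalSpace G] [IsTopologicalGroup G] [CompactSpace G], Literature.MathematicalPhysics.QuantumFieldTheory.IsCompactSimpleLieGroup G → Subgroup.center G = ⊥ → letI : MeasurableSpace G := borel G; haveI : BorelSpace G := ⟨rfl⟩; ∃ (r : Litera

/-! D-0027 §2.1 — DECIDING THEOREM (planner-authored via `route open/edit --closes-file`; by planner-rrepair-QuantumFields-FluxBootstrap-st-54739760-0 2026-08-16T17:36:20Z):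
its hypotheses are this route's items and its conclusion the sub-problem Statement (glue_lint), and it elaborates with this file. -/

/-- ROUTE GLUE (D-0027 §2.1), PURE LOGIC: the listed items imply the sub-problem statement
`YangMills` (revised 2026-08-16, p116790: first conjunct `sch.HasWeakCouplingLimit`). Case split on
the centre of `G`: for `Z(G) = ⊥` use `CentrelessWeakCouplingYangMills` (the revised clause for
centreless groups, weak-coupling conjunct included); for `Z(G) ≠ ⊥` the anchor supplies the faithful
representation `r` and the two-sidedly pinned scales `(β_k, S₀ k)` WITH `β_k → ∞`,
`SingleScaleFluxCriterion` turns the ε-criterion at `S₀ k` into Gaussian twist decay above `S₀ k`,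
`LargeBetaFluxGap` (weak coupling, eventually `β_k ≥ β₁`) turns that into volume-uniform clustering
at rate `m / S₀ k`, and `PinnedFluxGapToYangMills` — fed the SAME `r`, the pinning included, and the
clustering — returns the clause along a SUBSEQUENCE `sch.β = β ∘ φ`, `φ` strictly monotone; the new
conjunct `sch.HasWeakCouplingLimit` (`Tendsto sch.β atTop atTop`) is therefore PROVED here from the
anchor's `Tendsto β atTop atTop` composed with `StrictMono.tendsto_atTop` — no new hypothesis on the
flux side. The twisted partition function of the `∀ Z, hZ → …` items is instantiated by its defining
integral (`Z` below, by cases on the side). -/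
@[closes "route-QuantumFields-FluxBootstrap"] theorem closes (hFB : SingleScaleFluxCriterion) (hFG : LargeBetaFluxGap)
    (hAnchor : ContinuumFluxAnchor) (hLegs : PinnedFluxGapToYangMills)
    (hCentreless : CentrelessWeakCouplingYangMills) : YangMills := by
  intro G _ _ _ _ hG
  letI : MeasurableSpace G := borel G
  haveI : BorelSpace G := ⟨rfl⟩
  by_cases hc : Subgroup.center G = ⊥
  · exact hCentreless G hG hc
  · obtain ⟨r, hr⟩ := hAnchor G hG hc
    have hemb := r.continuous.isClosedEmbedding r.injective
    haveI : T2Space G := hemb.isEmbedding.t2Space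
    haveI : SecondCountableTopology G := hemb.isEmbedding.secondCountableTopology
    let Z : ℝ → ℕ → G → {p : Fin 4 × Fin 4 // p.1 < p.2} → ℝ := fun β S z q =>
      match S with
      | 0 => 0
      | L + 1 => ∫ U : Literature.MathematicalPhysics.QuantumFieldTheory.GaugeConfig 4 (L + 1) G,
          Real.exp (-(β * ∑ p : Literature.MathematicalPhysics.QuantumFieldTheory.Plaquette 4 (L + 1),
            ((r.N : ℝ) - (r.ρ ((if p.2 = q ∧ p.1 q.1.1 = 0 ∧ p.1 q.1.2 = 0 then z else 1) *
              Literature.MathematicalPhysics.QuantumFieldTheory.plaquetteHolonomy U p.1 p.2.1.1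
                p.2.1.2)).trace.re)))
          ∂(MeasureTheory.Measure.pi fun _ :
              Literature.MathematicalPhysics.QuantumFieldTheory.Edge 4 (L + 1) =>
            Literature.MathematicalPhysics.QuantumFieldTheory.haarProbability G)
    have hZ : ∀ (β : ℝ) (L : ℕ) (z : G) (q : {p : Fin 4 × Fin 4 // p.1 < p.2}), Z β (L + 1) z q =
        ∫ U : Literature.MathematicalPhysics.QuantumFieldTheory.GaugeConfig 4 (L + 1) G,
          Real.exp (-(β * ∑ p : Literature.MathematicalPhysics.QuantumFieldTheory.Plaquette 4 (L + 1),
            ((r.N : ℝ) - (r.ρ ((if p.2 = q ∧ p.1 q.1.1 = 0 ∧ p.1 q.1.2 = 0 then z else 1) *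
              Literature.MathematicalPhysics.QuantumFieldTheory.plaquetteHolonomy U p.1 p.2.1.1
                p.2.1.2)).trace.re)))
          ∂(MeasureTheory.Measure.pi fun _ :
              Literature.MathematicalPhysics.QuantumFieldTheory.Edge 4 (L + 1) =>
            Literature.MathematicalPhysics.QuantumFieldTheory.haarProbability G) :=
      fun _ _ _ _ => rfl
    obtain ⟨ε, c, C, hε, hc0, hC0, hfb⟩ := hFB G r.N r.ρ r.continuous r.mem_unitary Z hZ
    obtain ⟨m, β₁, hm, hfg⟩ := hFG G hG hc r Z hZ c C hc0 hC0
    have hε' : 0 < min ε (1 / 2) := lt_min hε (by norm_num)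
    have hε'1 : min ε (1 / 2) < 1 := lt_of_le_of_lt (min_le_right _ _) (by norm_num)
    obtain ⟨β, S₀, hβ0, hβ, hS₀, hev⟩ := hr Z hZ (min ε (1 / 2)) hε' hε'1
    have hclust : ∀ A B : Literature.MathematicalPhysics.QuantumFieldTheory.YMSpecies G, ∃ K : ℝ,
        ∀ᶠ k in Filter.atTop, ∀ S : ℕ, S₀ k ≤ S → ∀ n : ℕ, n ≤ S →
          |Literature.MathematicalPhysics.QuantumFieldTheory.latticeConnectedCorr r.ρ (β k) (2 * S + 1)
              A.F B.F n| ≤ K * Real.exp (-(m * n / S₀ k)) := by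
      intro A B
      obtain ⟨K, hK⟩ := hfg A B
      refine ⟨K, ?_⟩
      filter_upwards [hev, hS₀.eventually_ge_atTop 2, hβ.eventually_ge_atTop β₁] with k hk hk2 hkβ
      intro S hS n hn
      refine hK (β k) hkβ (S₀ k) hk2 ?_ S hS n hn
      intro S' hS' z hz q
      exact hfb (β k) (hβ0 k) (S₀ k) S' hk2 hS'
        (fun z hz q => le_trans (hk.1 z hz q) (min_le_left _ _)) z hz q
    obtain ⟨sch, T, ⟨φ, hφ, hφk⟩, hYM, hNT, hNG, Δ, hΔ, hgap, hlgap⟩ :=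
      hLegs G hG hc r Z hZ (min ε (1 / 2)) m β S₀ hε' hε'1 hm hβ0 hβ hS₀ hev hclust
    -- the NEW conjunct: β_k → ∞ (anchor) along the strictly monotone subsequence φ of the legs
    have hw : sch.HasWeakCouplingLimit :=
      (hβ.comp hφ.tendsto_atTop).congr fun k => ((hφk k).1).symm
    exact ⟨r, sch, T, hw, hYM, hNT, hNG, Δ, hΔ, hgap, hlgap⟩

end Summit.QuantumFields.YangMills.Theses.FluxBootstrap
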